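import Summits.BirchSwinnertonDyer.BirchSwinnertonDyer.Theorems.PrintCf2RubinValueTwoFrameSeed
import Summits.BirchSwinnertonDyer.BirchSwinnertonDyer.Theorems.PrintCf2RubinValueTwoKatzFrameSupply
import Summits.BirchSwinnertonDyer.BirchSwinnertonDyer.Theorems.PrintCf2SplitBadTwoAdaptedPairLine
import Summits.BirchSwinnertonDyer.BirchSwinnertonDyer.Theorems.PrintCf2SplitBadTwoTwistSign
import Literature.NumberTheory.EllipticCurves.DeShalit1987.KatzMeasureMonomialLinesFrames
import Literature.NumberTheory.EllipticCurves.IntSeriesValueNormRigidity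
import HarnessLib

/-!
# THE `v`-LINE INTERPOLATION SUPPLY AT THE SPLIT PRIME `2` OF `ℚ(√−7)`, FILE 1: the seed avatars factor through THE `v`-line, and the
# line family from a matched seed (crux `stmt-BirchSwinnertonDyer-24086` `PrintCf2RubinValueTwo.MainConjClauseAtSplitTwoQuad`, line
# `m_line_pin`, stub (A) `stub_vLineRestriction`; also stub (T))

Cell `bsd-print-cf2`, width seat `bsd-line-cf2c-w3` g6 (successor of g0–g5 on the route-C aside 23722); Theses-free;
`--supports stmt-BirchSwinnertonDyer-24033` (helper).  THEOREMS ONLY (no `def`, no named fact, no `sorry`).  FILE 1 of 2; file 2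
(`…VLineSupply`) assembles the supply for EVERY quadratic `θ_K` from cruxlead-23721 g3's B18s seed characters.

THE POINT.  Every analytic comparison on the `v`-line of `K = ℚ(√−7)` (`2 = v v̄`, `κ₁` THE `ℤ₂`-line unramified outside `v`) —
de Shalit II.4.12 restriction `π_v(G₂)` versus Müller's `ν`-branch `G₁` (stub (A)), the pseudo-branch of the trivial character (stub (T)),
two period pairs of one branch — reads two integral series at a GEOMETRIC PROGRESSION of in-range points `ε_t = θ_K⁻¹ρ_t` of type
`(−(m₀ + 2t), 0)`, nodes `r_t(γ₁⁻¹) − 1 = w·uᵗ − 1`.  When `θ_K` is RAMIFIED at `v` (the print class `χ_d ∘ N`, `d ≢ 1 (mod 4)`) the point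
`ε_t` is unramified at `v` only if `ρ_t|𝒪_vˣ = θ_K|𝒪_vˣ`: one needs Größencharaktere of conductor `𝔭_v², 𝔭_v³` whose avatars factor
through THE LINE `κ₁` (not merely through the pair).  The characters are cruxlead-23721 g3's B18s seeds `ω_A, ω_B`
(`FrameSeed.exists_seedChar_pair`, `exists_unitsChar_avatar_inv`); this file puts their avatars through `κ₁`:

* §1 norms of `ℤ₂ˣ`-valued avatar values (`norm_avatarValueAt_sub_one_lt_two_of_four_dvd`, `…_lt_one_of_units`).
* §2 `factorsThroughZp_of_principal_line` — the `χ₄`-seed avatar (principal: `≡ 1 mod 4`, so its values have no `2`-power torsion) factors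
  through `κ₁` by -w2 g13's saturation theorem for a GIVEN line (`SplitPrimeLine.factorsThroughZp_of_inertia_le_kerSubgroup`);
  `factorsThroughZp_of_rel_line` — the `χ₈′`-seed avatar dies with it (`FrameSeed.unitsChar_eq_one_of_rel`).
* §3 `lineSupply_of_matched` — from a matched seed `η` (type `(−a,0)`, unramified off `v`, avatar through `κ₁`, `θ_K⁻¹η` unramified at `v`)
  and an everywhere-unramified `Ψ` of type `(−2,0)` with avatar through `κ₁`: the family `ρ t = Ψᵗη`, `r t = e ⊗ ψᵗ`, nodes `w·uᵗ`, `u ≠ 1`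
  no root of unity, types `(−(a+2t), 0)`, ramification bookkeeping, entire `L`-functions.

HONEST FRAMING: plumbing over cruxlead-23721 g3's B18s files, -w2 g13 / -w5 g4's split-prime-line theorems and the bsd-eis `CycTangent…`
avatar kit; closes nothing by itself; beyond-print theorem: no.  BSD is not proved by any of this.

References: [deShalit1987] II.4.12, II.4.16 (49)–(50), II.4.17 (52)–(54); [SerreAbelianLadic1968] Ch. II §2.7, Ch. III §2.3;
[Washington1997] §5.1, §13.1 Thm. 13.4; [IrelandRosen1982] Ch. 18 §7.
-/


-- the summit namespace `Summit.BirchSwinnertonDyer.BirchSwinnertonDyer` repeats the problem name by design (D-0017)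
set_option linter.dupNamespace false
set_option autoImplicit false

noncomputable section

open scoped Classical

open NumberField IsDedekindDomain Field Filter Literature.NumberTheory.GaloisRepresentations
  Literature.NumberTheory.EllipticCurves Literature.NumberTheory.EllipticCurves.Rank1Residual
  Summit.BirchSwinnertonDyer.BirchSwinnertonDyer.Theorems.PrintCf2
  Summit.BirchSwinnertonDyer.BirchSwinnertonDyer.Theorems.PrintCf2.FrameSeed

namespace Summit.BirchSwinnertonDyer.BirchSwinnertonDyer.Theorems.PrintCf2.VLineSupplySeed

variable {K : Type} [Field K] [NumberField K]

/-! ## §1 Small algebra and norms -/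

/-- `‖2‖ = 2⁻¹` in `ℂ₂`. [folklore] -/
theorem norm_two_padicComplex : ‖(2 : ℂ_[2])‖ = (2 : ℝ)⁻¹ := by
  rw [show (2 : ℂ_[2]) = ((2 : ℕ) : ℂ_[2]) by norm_num, ← PadicComplex.coe_natCast 2 2, PadicComplex.norm_extends 2,
    PadicAlgCl.norm_natCast_self]
  norm_num

omit [NumberField K] in
/-- The determinant of a rank-one framed `r σ` with entry `j(x)`, `x ∈ ℤ₂`, is `j(x)` (`j : ℤ₂ → ℚ₂ → ℚ̄₂`). [folklore] -/
private theorem det_eq_of_entry {r : FramedGaloisRep K (PadicAlgCl 2) 1} {χz : absoluteGaloisGroup K →ₜ* ℤ_[2]ˣ}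
    (hr : ∀ σ, (((r σ : GL (Fin 1) (PadicAlgCl 2)) : Matrix (Fin 1) (Fin 1) (PadicAlgCl 2)) 0 0) =
      algebraMap ℚ_[2] (PadicAlgCl 2) (((χz σ : ℤ_[2]ˣ) : ℤ_[2]) : ℚ_[2])) (σ : absoluteGaloisGroup K) :
    ((Matrix.GeneralLinearGroup.det (r σ) : (PadicAlgCl 2)ˣ) : PadicAlgCl 2) =
      ((algebraMap ℚ_[2] (PadicAlgCl 2)).comp PadicInt.Coe.ringHom) ((χz σ : ℤ_[2]ˣ) : ℤ_[2]) := by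
  rw [Matrix.GeneralLinearGroup.val_det_apply, Matrix.det_fin_one, hr σ, RingHom.comp_apply, PadicInt.Coe.ringHom_apply]

omit [NumberField K] in
/-- `r̂(σ) − 1 = j(x − 1)` read in `ℂ₂`. [folklore] -/
private theorem avatarValueAt_sub_one_eq {r : FramedGaloisRep K (PadicAlgCl 2) 1} {χz : absoluteGaloisGroup K →ₜ* ℤ_[2]ˣ}
    (hr : ∀ σ, (((r σ : GL (Fin 1) (PadicAlgCl 2)) : Matrix (Fin 1) (Fin 1) (PadicAlgCl 2)) 0 0) =
      algebraMap ℚ_[2] (PadicAlgCl 2) (((χz σ : ℤ_[2]ˣ) : ℤ_[2]) : ℚ_[2])) (σ : absoluteGaloisGroup K) :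
    avatarValueAt r σ - 1 =
      ((((algebraMap ℚ_[2] (PadicAlgCl 2)).comp PadicInt.Coe.ringHom) (((χz σ : ℤ_[2]ˣ) : ℤ_[2]) - 1) : PadicAlgCl 2) : ℂ_[2]) := by
  rw [avatarValueAt, det_eq_of_entry hr σ, map_sub, map_one, UniformSpace.Completion.coe_sub, UniformSpace.Completion.coe_one]

omit [NumberField K] in
/-- **The value bound for a principal `ℤ₂ˣ`-valued avatar**: if the entry of the rank-one framed `r σ` is `j(x)` for `x ∈ ℤ₂ˣ` with
`4 ∣ x − 1` (`j : ℤ₂ → ℚ₂ → ℚ̄₂`), then `‖r̂(σ) − 1‖ < ‖2‖` in `ℂ₂`. [cite: deShalit1987, II.4.17 (54)] -/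
theorem norm_avatarValueAt_sub_one_lt_two_of_four_dvd {r : FramedGaloisRep K (PadicAlgCl 2) 1}
    {χz : absoluteGaloisGroup K →ₜ* ℤ_[2]ˣ}
    (hr : ∀ σ, (((r σ : GL (Fin 1) (PadicAlgCl 2)) : Matrix (Fin 1) (Fin 1) (PadicAlgCl 2)) 0 0) =
      algebraMap ℚ_[2] (PadicAlgCl 2) (((χz σ : ℤ_[2]ˣ) : ℤ_[2]) : ℚ_[2]))
    {σ : absoluteGaloisGroup K} (h4 : (4 : ℤ_[2]) ∣ ((χz σ : ℤ_[2]ˣ) : ℤ_[2]) - 1) :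
    ‖avatarValueAt r σ - 1‖ < ‖(2 : ℂ_[2])‖ := by
  rw [avatarValueAt_sub_one_eq hr σ, UniformSpace.Completion.norm_coe, RingHom.comp_apply, norm_algebraMap',
    PadicInt.Coe.ringHom_apply, PadicInt.padic_norm_e_of_padicInt, norm_two_padicComplex]
  have hle : ‖((χz σ : ℤ_[2]ˣ) : ℤ_[2]) - 1‖ ≤ ((2 : ℕ) : ℝ) ^ (-((2 : ℕ) : ℤ)) := by
    rw [PadicInt.norm_le_pow_iff_mem_span_pow, Ideal.mem_span_singleton]
    norm_num
    exact h4
  calc ‖((χz σ : ℤ_[2]ˣ) : ℤ_[2]) - 1‖ ≤ ((2 : ℕ) : ℝ) ^ (-((2 : ℕ) : ℤ)) := hle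
    _ < (2 : ℝ)⁻¹ := by norm_num

omit [NumberField K] in
/-- **A `ℤ₂ˣ`-valued avatar takes one-unit values**: entry `j(x)`, `x ∈ ℤ₂ˣ` ⟹ `‖r̂(σ) − 1‖ < 1`. [cite: deShalit1987, II.4.17 (54)] -/
theorem norm_avatarValueAt_sub_one_lt_one_of_units {r : FramedGaloisRep K (PadicAlgCl 2) 1}
    {χz : absoluteGaloisGroup K →ₜ* ℤ_[2]ˣ}
    (hr : ∀ σ, (((r σ : GL (Fin 1) (PadicAlgCl 2)) : Matrix (Fin 1) (Fin 1) (PadicAlgCl 2)) 0 0) =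
      algebraMap ℚ_[2] (PadicAlgCl 2) (((χz σ : ℤ_[2]ˣ) : ℤ_[2]) : ℚ_[2]))
    (σ : absoluteGaloisGroup K) : ‖avatarValueAt r σ - 1‖ < 1 := by
  rw [avatarValueAt_sub_one_eq hr σ, UniformSpace.Completion.norm_coe, RingHom.comp_apply, norm_algebraMap',
    PadicInt.Coe.ringHom_apply, PadicInt.padic_norm_e_of_padicInt, PadicInt.norm_lt_one_iff_dvd]
  -- `x` is a unit of `ℤ₂`, so `x ≡ 1 (mod 2)`
  obtain ⟨u, hu⟩ : IsUnit (PadicInt.toZMod ((χz σ : ℤ_[2]ˣ) : ℤ_[2])) := (χz σ).isUnit.map PadicInt.toZMod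
  have hu1 : u = 1 := Subsingleton.elim u 1
  rw [hu1, Units.val_one] at hu
  rw [← Ideal.mem_span_singleton, ← PadicInt.maximalIdeal_eq_span_p, ← PadicInt.ker_toZMod, RingHom.mem_ker, map_sub,
    map_one, ← hu, sub_self]

omit [NumberField K] in
/-- The norm of an avatar value is `1` when it is a one-unit. [folklore] -/
theorem norm_avatarValueAt_eq_one_of_lt {r : FramedGaloisRep K (PadicAlgCl 2) 1} {σ : absoluteGaloisGroup K}
    (h : ‖avatarValueAt r σ - 1‖ < 1) : ‖avatarValueAt r σ‖ = 1 := by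
  have e : avatarValueAt r σ = avatarValueAt r σ - 1 + 1 := by ring
  rw [e]
  exact IsUltrametricDist.norm_add_eq_max_of_norm_ne_norm (by rw [norm_one]; exact h.ne) |>.trans
    (by rw [norm_one]; exact max_eq_right h.le)

/-- One-units are closed under products: `‖x − 1‖ < c`, `‖y − 1‖ < c`, `‖x‖ = 1`... in the form needed here:
`‖xy − 1‖ ≤ max ‖x − 1‖ ‖y − 1‖` when `‖y‖ ≤ 1`. [folklore] -/
theorem norm_mul_sub_one_le {x y : ℂ_[2]} (hy : ‖y‖ ≤ 1) : ‖x * y - 1‖ ≤ max ‖x - 1‖ ‖y - 1‖ := by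
  have e : x * y - 1 = (x - 1) * y + (y - 1) := by ring
  rw [e]
  refine (IsUltrametricDist.norm_add_le_max _ _).trans (max_le_max ?_ le_rfl)
  calc ‖(x - 1) * y‖ = ‖x - 1‖ * ‖y‖ := norm_mul _ _
    _ ≤ ‖x - 1‖ * 1 := by gcongr
    _ = ‖x - 1‖ := mul_one _

/-! ## §2 The seed avatars factor through THE `v`-line `κ₁` -/

section Line

open Summit.BirchSwinnertonDyer.BirchSwinnertonDyer.Theorems.PrintCf2.SplitPrimeLine

variable {v vbar : HeightOneSpectrum (𝓞 K)} {φ₀ : 𝓞 K →+* ℤ_[2]}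

/-- **A PRINCIPAL `ℤ₂ˣ`-valued avatar through the pair factors through THE `v`-LINE.**  `K` imaginary quadratic, `2 = v v̄`,
`(κ₁, κ₂; γ₁, γ₂)` a generator pair with `κ₁` unramified outside `v`; `r` rank one with entries `j(χz σ)`, `χz σ ≡ 1 (mod 4)` for all
`σ`, through the pair and unramified at `v̄`.  Then `r` factors through `κ₁`: its values are one-units of level `< ‖2‖`, hence have
no `2`-power torsion, and -w2 g13's saturation theorem for the given line `κ₁` (which kills every inertia group above `v̄`) applies.
[cite: deShalit1987, II.4.17 (52)–(54)] [cite: Washington1997, §13.1 Thm. 13.4] -/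
theorem factorsThroughZp_of_principal_line (hK : IsImaginaryQuadratic K)
    (hv2 : ((2 : ℕ) : 𝓞 K) ∈ v.asIdeal) (hvbar : ((2 : ℕ) : 𝓞 K) ∈ vbar.asIdeal) (hne : vbar ≠ v)
    {κ₁ κ₂ : ZpExtension K 2} {γ₁ γ₂ : absoluteGaloisGroup K} (hpair : ZpExtension.IsTopGeneratorPair κ₁ κ₂ γ₁ γ₂)
    (hκ₁ : κ₁.IsUnramifiedOutside v)
    {r : FramedGaloisRep K (PadicAlgCl 2) 1} {χz : absoluteGaloisGroup K →ₜ* ℤ_[2]ˣ}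
    (hr : ∀ σ, (((r σ : GL (Fin 1) (PadicAlgCl 2)) : Matrix (Fin 1) (Fin 1) (PadicAlgCl 2)) 0 0) =
      algebraMap ℚ_[2] (PadicAlgCl 2) (((χz σ : ℤ_[2]ˣ) : ℤ_[2]) : ℚ_[2]))
    (h4 : ∀ σ, (4 : ℤ_[2]) ∣ ((χz σ : ℤ_[2]ˣ) : ℤ_[2]) - 1)
    (hrpair : FactorsThroughPair κ₁ κ₂ r) (hrunr : r.IsUnramifiedAt vbar) :
    FactorsThroughZp κ₁ r :=
  factorsThroughZp_of_inertia_le_kerSubgroup hK hv2 hvbar hne hpair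
    (fun _ h𝔓 ↦ inertia_le_kerSubgroup_of_isUnramifiedOutside hκ₁ hne h𝔓) hrpair hrunr
    (fun σ n h ↦ avatarValueAt_torsionFree_of_norm_sub_one_lt (p := 2)
      (fun τ ↦ by simpa using norm_avatarValueAt_sub_one_lt_two_of_four_dvd hr (h4 τ)) σ n h)

variable (hv : ∀ k : 𝓞 K, k ∈ v.asIdeal ↔ (2 : ℤ_[2]) ∣ φ₀ k)
include hv

/-- **The `χ₈'`-seed avatar factors through the line wherever the `χ₄`-seed avatar does** (`χz_B = χz_A · χ₈(χz_A)` everywhere,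
cruxlead-23721 g3's `FrameSeed.unitsChar_eq_one_of_rel`). [cite: deShalit1987, II.4.17 (52)] [cite: SerreAbelianLadic1968, Ch. I §2.2] -/
theorem factorsThroughZp_of_rel_line {κ : ZpExtension K 2}
    {rA rB : FramedGaloisRep K (PadicAlgCl 2) 1} {χzA χzB : absoluteGaloisGroup K →ₜ* ℤ_[2]ˣ}
    (hrA : ∀ σ, (((rA σ : GL (Fin 1) (PadicAlgCl 2)) : Matrix (Fin 1) (Fin 1) (PadicAlgCl 2)) 0 0) =
      algebraMap ℚ_[2] (PadicAlgCl 2) (((χzA σ : ℤ_[2]ˣ) : ℤ_[2]) : ℚ_[2]))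
    (hrB : ∀ σ, (((rB σ : GL (Fin 1) (PadicAlgCl 2)) : Matrix (Fin 1) (Fin 1) (PadicAlgCl 2)) 0 0) =
      algebraMap ℚ_[2] (PadicAlgCl 2) (((χzB σ : ℤ_[2]ˣ) : ℤ_[2]) : ℚ_[2]))
    {g : HeightOneSpectrum (𝓞 K) → 𝓞 K} (hg : ∀ w : HeightOneSpectrum (𝓞 K), w ≠ v → g w ∉ v.asIdeal)
    (hA : ∀ w : HeightOneSpectrum (𝓞 K), w ≠ v → ((2 : ℕ) : 𝓞 K) ∉ w.asIdeal →
      ∀ 𝔓 ∈ w.primesAbove, ∀ Φ : absoluteGaloisGroup K, IsArithFrobAt (𝓞 K) Φ 𝔓 →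
        ((χzA Φ : ℤ_[2]ˣ) : ℤ_[2]) = φ₀ (g w) *
          ((ZMod.χ₈ (PadicInt.toZModPow 3 (φ₀ (g w))) * ZMod.χ₈' (PadicInt.toZModPow 3 (φ₀ (g w))) : ℤ) : ℤ_[2]))
    (hB : ∀ w : HeightOneSpectrum (𝓞 K), w ≠ v → ((2 : ℕ) : 𝓞 K) ∉ w.asIdeal →
      ∀ 𝔓 ∈ w.primesAbove, ∀ Φ : absoluteGaloisGroup K, IsArithFrobAt (𝓞 K) Φ 𝔓 →
        ((χzB Φ : ℤ_[2]ˣ) : ℤ_[2]) = φ₀ (g w) * ((ZMod.χ₈' (PadicInt.toZModPow 3 (φ₀ (g w))) : ℤ) : ℤ_[2]))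
    (hfA : FactorsThroughZp κ rA) : FactorsThroughZp κ rB := by
  intro σ hσ
  have h1 : ((χzA σ : ℤ_[2]ˣ) : ℤ_[2]) = 1 := by
    have h := entry_eq_one_of_framedRep_eq_one rA (hfA σ hσ)
    rw [hrA σ, ← map_one (algebraMap ℚ_[2] (PadicAlgCl 2))] at h
    exact PadicInt.ext (by rw [PadicInt.coe_one]; exact (algebraMap ℚ_[2] (PadicAlgCl 2)).injective h)
  have hA1 : χzA σ = 1 := Units.ext (by rw [h1, Units.val_one])
  have hB1 : χzB σ = 1 := unitsChar_eq_one_of_rel hv χzA χzB hg hA hB hA1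
  exact framedRep_eq_one_of_entry rB (by rw [hrB σ, hB1, Units.val_one, PadicInt.coe_one, map_one])

end Line

/-! ## §3 The line supply -/

section Supply

open Summit.BirchSwinnertonDyer.Rank1Residual.X11b.LambdaSupply
  Summit.BirchSwinnertonDyer.Rank1Residual.X11b.Three.LambdaSupply
  Summit.BirchSwinnertonDyer.BirchSwinnertonDyer.Theorems.CycTangentCMCycTangentBoundInterpolationContinuation
  Summit.BirchSwinnertonDyer.BirchSwinnertonDyer.Theorems.CycTangentCMCycTangentBoundAvatarRamified

omit [NumberField K] in
/-- The avatar value at `σ` with `κ σ = 1` of a character through `κ` is `1`. [cite: deShalit1987, II.4.17 (52)] -/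
theorem avatarValueAt_eq_one_of_factorsThroughZp {κ : ZpExtension K 2} {r : FramedGaloisRep K (PadicAlgCl 2) 1}
    (h : FactorsThroughZp κ r) {σ : absoluteGaloisGroup K} (hσ : κ σ = 1) : avatarValueAt r σ = 1 := by
  rw [avatarValueAt, h σ hσ]; simp

omit [NumberField K] in
/-- A rank-one framed representation whose avatar value at `σ` is `1` is trivial at `σ`. [folklore] -/
theorem apply_eq_one_of_avatarValueAt_eq_one {r : FramedGaloisRep K (PadicAlgCl 2) 1} {σ : absoluteGaloisGroup K}
    (h : avatarValueAt r σ = 1) : r σ = 1 := by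
  refine framedRep_eq_one_of_entry r ((algebraMap (PadicAlgCl 2) ℂ_[2]).injective ?_)
  rw [← TwistSign.avatarValueAt_eq_algebraMap_entry, h, map_one]

/-- **FROM A MATCHED SEED AND AN EVERYWHERE-UNRAMIFIED CHARACTER TO THE LINE SUPPLY.**  Data: a generator pair; `θ_K` quadratic; a seed
`η` of type `(−a, 0)`, `0 < a`, unramified off `v`, with avatar `e` THROUGH `κ₁` and `θ_K⁻¹η` unramified at `v`, `‖e(γ₁⁻¹) − 1‖ < 1`;
a character `Ψ` of type `(−2, 0)` unramified EVERYWHERE with avatar `ψ` through `κ₁` and `‖ψ(γ₁⁻¹) − 1‖ < ‖2‖`.  Output: the family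
`ρ t = Ψᵗ·η`, `r t = e ⊗ ψᵗ` with nodes `w·uᵗ`, `w = e(γ₁⁻¹)`, `u = ψ(γ₁⁻¹) ≠ 1` (no root of unity: else `ψ ≡ 1` on the line, so `ψ` would be
unramified at `v`, impossible for a non-zero infinity type), types `(−(a + 2t), 0)`, the ramification bookkeeping and entire `L`-functions.
[cite: deShalit1987, II.4.16 (49)–(50), II.4.17 (52)–(54)] [cite: Washington1997, §13.1] -/
theorem lineSupply_of_matched (hK : IsImaginaryQuadratic K)
    {ι : PadicAlgCl 2 ≃+* ℂ} {v vbar : HeightOneSpectrum (𝓞 K)}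
    (hv2 : ((2 : ℕ) : 𝓞 K) ∈ v.asIdeal) (hvbar : ((2 : ℕ) : 𝓞 K) ∈ vbar.asIdeal) (hne : vbar ≠ v)
    (hι : ∀ (w : InfinitePlace K) (k : 𝓞 K), k ∈ v.asIdeal ↔ ‖ι.symm (w.embedding (k : K))‖ < 1)
    {κ₁ κ₂ : ZpExtension K 2} {γ₁ γ₂ : absoluteGaloisGroup K} (hpair : ZpExtension.IsTopGeneratorPair κ₁ κ₂ γ₁ γ₂)
    {θK : HeckeCharacter K} (hθ : θK * θK = 1)
    {η : HeckeCharacter K} {e : FramedGaloisRep K (PadicAlgCl 2) 1} {a : ℕ} (ha : 0 < a)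
    (he : IsPAdicAvatarOf ι η e) (heκ : FactorsThroughZp κ₁ e)
    (hηu : ∀ w : HeightOneSpectrum (𝓞 K), w ≠ v → η.IsUnramifiedAt w)
    (hηt : η.HasInfinityType (fun _ ↦ -(a : ℤ)) (fun _ ↦ 0))
    (hmatch : (θK⁻¹ * η).IsUnramifiedAt v) (hwe : ‖avatarValueAt e γ₁⁻¹ - 1‖ < 1)
    {Ψ : HeckeCharacter K} {ψ : FramedGaloisRep K (PadicAlgCl 2) 1}
    (hψ : IsPAdicAvatarOf ι Ψ ψ) (hψκ : FactorsThroughZp κ₁ ψ) (hΨu : ∀ w : HeightOneSpectrum (𝓞 K), Ψ.IsUnramifiedAt w)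
    (hΨt : Ψ.HasInfinityType (fun _ ↦ -((2 : ℕ) : ℤ)) (fun _ ↦ 0))
    (hψsmall : ‖avatarValueAt ψ γ₁⁻¹ - 1‖ < ‖(2 : ℂ_[2])‖) :
    ∃ (ρ : ℕ → HeckeCharacter K) (r : ℕ → FramedGaloisRep K (PadicAlgCl 2) 1) (w u : ℂ_[2]) (m₀ N : ℕ),
      0 < m₀ ∧ 0 < N ∧ ‖w - 1‖ < 1 ∧ ‖u - 1‖ < ‖(2 : ℂ_[2])‖ ∧ u ≠ 1 ∧ (∀ n : ℕ, 0 < n → u ^ n ≠ 1) ∧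
      ∀ t : ℕ,
        IsPAdicAvatarOf ι (ρ t) (r t) ∧ FactorsThroughZp κ₁ (r t) ∧ FactorsThroughPair κ₁ κ₂ (r t) ∧
        avatarValueAt (r t) γ₁⁻¹ = w * u ^ t ∧ avatarValueAt (r t) γ₂⁻¹ = 1 ∧
        0 < m₀ + N * t ∧
        (θK⁻¹ * ρ t).HasInfinityType (fun _ ↦ -((m₀ + N * t : ℕ) : ℤ)) (fun _ ↦ 0) ∧
        (∀ w' : HeightOneSpectrum (𝓞 K), w' ≠ v → (ρ t).IsUnramifiedAt w') ∧
        (θK⁻¹ * ρ t).IsUnramifiedAt v ∧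
        (∀ w' : HeightOneSpectrum (𝓞 K), w' ≠ v → θK.IsUnramifiedAt w' → (θK⁻¹ * ρ t).IsUnramifiedAt w') ∧
        LFunction.HasEntireContinuation (heckeLFunction (θK⁻¹ * ρ t)) := by
  have hΨu2 : ∀ w : HeightOneSpectrum (𝓞 K), ((2 : ℕ) : 𝓞 K) ∉ w.asIdeal → Ψ.IsUnramifiedAt w := fun w _ ↦ hΨu w
  -- the family
  let r : ℕ → FramedGaloisRep K (PadicAlgCl 2) 1 := fun t ↦ Nat.rec e (fun _ x ↦ FramedRep.twist x (detChar ψ)) t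
  have hr0 : r 0 = e := rfl
  have hrS : ∀ t, r (t + 1) = FramedRep.twist (r t) (detChar ψ) := fun t ↦ rfl
  let ρ : ℕ → HeckeCharacter K := fun t ↦ Ψ ^ t * η
  have hρ : ∀ t, ρ t = Ψ ^ t * η := fun t ↦ rfl
  set w : ℂ_[2] := avatarValueAt e γ₁⁻¹ with hw
  set u : ℂ_[2] := avatarValueAt ψ γ₁⁻¹ with hu
  -- avatars
  have hav : ∀ t, IsPAdicAvatarOf ι (ρ t) (r t) := by
    intro t
    induction t with
    | zero => rw [hρ, pow_zero, one_mul, hr0]; exact he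
    | succ t ih =>
      have h := ih.mul_twist hψ hΨu2
      rw [hρ, pow_succ', mul_assoc, hrS]
      exact h
  -- through the line
  have hκ : ∀ t, FactorsThroughZp κ₁ (r t) := by
    intro t
    induction t with
    | zero => rw [hr0]; exact heκ
    | succ t ih => rw [hrS]; exact factorsThroughZp_twist_detChar ih hψκ
  -- nodes
  have hnode : ∀ t, avatarValueAt (r t) γ₁⁻¹ = w * u ^ t := by
    intro t
    induction t with
    | zero => rw [hr0, pow_zero, mul_one]
    | succ t ih => rw [hrS, avatarValueAt_twist_detChar, ih, pow_succ]; ring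
  have hγ₂ : κ₁ γ₂⁻¹ = 1 := ZpExtension.mem_kerSubgroup.mp (κ₁.kerSubgroup.inv_mem hpair.2.2.1)
  -- infinity types
  have hθt : θK⁻¹.HasInfinityType (fun _ ↦ 0) (fun _ ↦ 0) := by
    rw [inv_eq_self_of_mul_self hθ]; exact hasInfinityType_zero_of_mul_self hθ
  have htype : ∀ t, (θK⁻¹ * ρ t).HasInfinityType (fun _ ↦ -((a + 2 * t : ℕ) : ℤ)) (fun _ ↦ 0) := by
    intro t
    have h := hθt.mul' ((HasInfinityType.pow_nat hΨt t).mul' hηt)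
    rw [hρ]
    convert h using 2
    · simp only [Pi.add_apply]; push_cast; ring
    · simp only [Pi.add_apply]; ring
  -- ramification
  have hρu : ∀ t (w' : HeightOneSpectrum (𝓞 K)), w' ≠ v → (ρ t).IsUnramifiedAt w' :=
    fun t w' hw' ↦ (isUnramifiedAt_pow' (hΨu w') t).mul' (hηu w' hw')
  have hρv : ∀ t, (θK⁻¹ * ρ t).IsUnramifiedAt v := by
    intro t
    rw [hρ, mul_left_comm]
    exact (isUnramifiedAt_pow' (hΨu v) t).mul' hmatch
  -- `u ≠ 1`
  have hune : u ≠ 1 := by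
    intro hu1
    have hγ : avatarValueAt ψ γ₁ = 1 := by
      have h := avatarValueAt_inv_mul ψ γ₁
      rwa [← hu, hu1, one_mul] at h
    have hall : ∀ σ, avatarValueAt ψ σ = 1 := fun σ ↦ by
      rw [ZpExtension.avatarValueAt_eq_onePlusPow hψκ hpair.1 σ, hγ, sub_self]
      have h := IntSeries.norm_onePlusPow_sub_one_le (Multiplicative.toAdd (κ₁ σ)) (x := (0 : ℂ_[2]))
        (by rw [norm_zero]; exact one_pos)
      rw [norm_zero] at h
      exact sub_eq_zero.mp (norm_le_zero_iff.mp h)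
    have hunr : ψ.IsUnramifiedAt v := fun 𝔓 _ τ _ ↦ apply_eq_one_of_avatarValueAt_eq_one (hall τ)
    exact not_isUnramifiedAt_avatar_of_hasInfinityType_ne_zero ι hK hv2 hvbar hne hι (k := -((2 : ℕ) : ℤ)) (by norm_num) hΨt
      (T := ∅) (fun w _ ↦ hΨu w) (hΨu v) hψ hunr
  have hroot : ∀ n : ℕ, 0 < n → u ^ n ≠ 1 :=
    IntSeries.forall_pow_ne_one_of_norm_sub_one_lt hune (by simpa using hψsmall)
  refine ⟨ρ, r, w, u, a, 2, ha, two_pos, hwe, hψsmall, hune, hroot, fun t ↦ ⟨hav t, hκ t,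
    FactorsThroughZp.factorsThroughPair_left κ₂ (hκ t), hnode t, avatarValueAt_eq_one_of_factorsThroughZp (hκ t) hγ₂, by omega,
    htype t, hρu t, hρv t, fun w' hw' hθw ↦ hθw.inv'.mul' (hρu t w' hw'), ?_⟩⟩
  exact hasEntireContinuation_of_hasInfinityType hK (j := 0) (m := a + 2 * t) (by omega) (by simpa using htype t)

end Supply

end Summit.BirchSwinnertonDyer.BirchSwinnertonDyer.Theorems.PrintCf2.VLineSupplySeed

end
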